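import Summits.Ventures.HodgeRepro.CosetQuadCore

/-!
# The twisted segment and the twisted rectangle of degree 16 (route-2's Theorems S and T on `SD₁₆` and `M₁₆`)

Blind re-derivation cell `pub-hodge-repro`, seat `p1` (gen 12).  ROUTE-B §9.17 / §9.39 (route-2 g31, INBOX L1177):
the 576 non-coset single-class instances of degree 16 live on the semidihedral group `SD₁₆` and the modular group
`M₁₆`, in two shapes — the **twisted segment** `Δ_S = {1, v, v², w}` (Theorem S) and the **twisted rectangle**
`Δ_T = {1, u, v, vu}` (Theorem T (i), `k = 4`).  This file puts the EXISTENCE of both on the kernel, for every finite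
`(G, c)` containing `SD₁₆` or `M₁₆` through `c`: the model groups `TwistGroup s = ℤ/8 ⋊ ℤ/2` with `u` acting by
`x ↦ s x` (`s = 3`: `SD₁₆`, `u v u⁻¹ = v³ = c v⁻¹`; `s = 5`: `M₁₆`, `u v u⁻¹ = v⁵ = c v`), `c = v⁴`; the hom
`modelHom : TwistGroup s →* G` from `v, u ∈ G` with `v⁸ = 1`, `u² = 1`, `u v u⁻¹ = vˢ` (injective for `v` of order
`8` and `u ∉ ⟨v⟩`); explicit CM types of the models (one of route-2's 8 instances each — `segSD`, `rectSD`, `typeM`)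
whose local conditions are DECIDED on the 16-element models and transported by gen 10's `exists_quad_of_pattern`
(`exists_quad_of_model`); the theorems `exists_segmentQuad_SD16` / `exists_twistedRectQuad_SD16` /
`exists_segmentQuad_M16` (segment `{1, v, v², v³u}`, `w = v³u` with `w² = v²`, `w v w⁻¹ = c v` as in route-2's (M)
form) / `exists_twistedRectQuad_M16`, and their instances on the model groups themselves.  Route-2's counts (8 + 8
per group) were reproduced by the seat's enumeration (proofs/p1-g12/tswitness.py) and are not claimed on the kernel.
-/

set_option autoImplicit false

open Finset Multiplicative
open scoped Pointwise

namespace HodgeRepro.TwistedQuad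

open HodgeRepro.CosetQuad

/-! ### The model groups `ℤ/8 ⋊ ℤ/2` -/

/-- Multiplication by `s` on `ℤ/8` (`s² = 1`), as a multiplicative automorphism. -/
def twistAut (s : ZMod 8) (hs : s * s = 1) : Multiplicative (ZMod 8) ≃* Multiplicative (ZMod 8) where
  toFun x := ofAdd (s * toAdd x)
  invFun x := ofAdd (s * toAdd x)
  left_inv x := by
    show ofAdd (s * toAdd (ofAdd (s * toAdd x))) = x
    rw [toAdd_ofAdd, ← mul_assoc, hs, one_mul, ofAdd_toAdd]
  right_inv x := by
    show ofAdd (s * toAdd (ofAdd (s * toAdd x))) = x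
    rw [toAdd_ofAdd, ← mul_assoc, hs, one_mul, ofAdd_toAdd]
  map_mul' x y := by
    show ofAdd (s * toAdd (x * y)) = ofAdd (s * toAdd x) * ofAdd (s * toAdd y)
    rw [toAdd_mul, mul_add, ofAdd_add]

/-- The twist automorphism is an involution. -/
theorem twistAut_sq (s : ZMod 8) (hs : s * s = 1) : twistAut s hs ^ 2 = 1 := by
  ext x
  show twistAut s hs (twistAut s hs x) = x
  exact (twistAut s hs).left_inv x

/-- The action `ℤ/2 →* Aut(ℤ/8)`, the generator acting by `twistAut s`. -/
def twistPhi (s : ZMod 8) (hs : s * s = 1) : Multiplicative (ZMod 2) →* MulAut (Multiplicative (ZMod 8)) :=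
  zmodPowHom 2 (twistAut s hs) (twistAut_sq s hs)

/-- The model group `ℤ/8 ⋊_s ℤ/2`: the semidihedral group `SD₁₆` for `s = 3`, the modular group `M₁₆` for `s = 5`. -/
abbrev TwistGroup (s : ZMod 8) (hs : s * s = 1) : Type :=
  Multiplicative (ZMod 8) ⋊[twistPhi s hs] Multiplicative (ZMod 2)

/-- `(TwistGroup s hs)` is a finite type (through the product of its two coordinates). -/
instance (s : ZMod 8) (hs : s * s = 1) : Fintype (TwistGroup s hs) :=
  Fintype.ofEquiv (Multiplicative (ZMod 8) × Multiplicative (ZMod 2))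
    { toFun := fun p => ⟨p.1, p.2⟩, invFun := fun x => (x.left, x.right),
      left_inv := fun _ => rfl, right_inv := fun _ => rfl }

/-- Equality on `(TwistGroup s hs)` is decidable (coordinatewise). -/
instance (s : ZMod 8) (hs : s * s = 1) : DecidableEq (TwistGroup s hs) := fun x y =>
  decidable_of_iff (x.left = y.left ∧ x.right = y.right)
    ⟨fun h => SemidirectProduct.ext h.1 h.2, fun h => ⟨congrArg _ h, congrArg _ h⟩⟩

/-- The rotation `v = (1, 0)` of the model group, of order `8`. -/
def tv (s : ZMod 8) (hs : s * s = 1) : TwistGroup s hs := SemidirectProduct.inl (ofAdd 1)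

/-- The involution `u = (0, 1)` of the model group, acting on `⟨v⟩` by `v ↦ vˢ`. -/
def tu (s : ZMod 8) (hs : s * s = 1) : TwistGroup s hs := SemidirectProduct.inr (ofAdd 1)

/-- The central involution `c = v⁴ = (4, 0)` of the model group. -/
def tc (s : ZMod 8) (hs : s * s = 1) : TwistGroup s hs := SemidirectProduct.inl (ofAdd 4)

/-- `3² = 1` in `ℤ/8`. -/
theorem three_sq : (3 : ZMod 8) * 3 = 1 := by decide

/-- `5² = 1` in `ℤ/8`. -/
theorem five_sq : (5 : ZMod 8) * 5 = 1 := by decide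

/-- The semidihedral group of order 16: `u v u⁻¹ = v³`. -/
abbrev SD16 : Type := TwistGroup 3 three_sq

/-- The modular group of order 16: `u v u⁻¹ = v⁵`. -/
abbrev M16 : Type := TwistGroup 5 five_sq

/-- The twisted segment `{1, v, v², u}` (route-2's `Δ_S` in the `SD` form, `w = u`). -/
def segSDT (s : ZMod 8) (hs : s * s = 1) : Fin 4 → TwistGroup s hs := ![1, tv s hs, tv s hs ^ 2, tu s hs]

/-- The twisted segment `{1, v, v², v³ u}` (route-2's `Δ_S` in the `M` form, `w = v³ u`). -/
def segMT (s : ZMod 8) (hs : s * s = 1) : Fin 4 → TwistGroup s hs :=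
  ![1, tv s hs, tv s hs ^ 2, tv s hs ^ 3 * tu s hs]

/-- The twisted rectangle `{1, u, v, v u}` (route-2's `Δ_T`). -/
def rectT (s : ZMod 8) (hs : s * s = 1) : Fin 4 → TwistGroup s hs :=
  ![1, tu s hs, tv s hs, tv s hs * tu s hs]

/-- A segment instance on `SD₁₆`: the CM type `{(0,0), (0,1), (1,1), (2,0), (3,0), (5,0), (6,1), (7,1)}`
(coordinates `(n, g) ↦ vⁿ uᵍ`). -/
def segSD : Finset SD16 :=
  {⟨ofAdd 0, ofAdd 0⟩, ⟨ofAdd 0, ofAdd 1⟩, ⟨ofAdd 1, ofAdd 1⟩, ⟨ofAdd 2, ofAdd 0⟩,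
    ⟨ofAdd 3, ofAdd 0⟩, ⟨ofAdd 5, ofAdd 0⟩, ⟨ofAdd 6, ofAdd 1⟩, ⟨ofAdd 7, ofAdd 1⟩}

/-- A twisted-rectangle instance on `SD₁₆`: `{(0,0), (0,1), (1,1), (2,1), (3,0), (5,0), (6,0), (7,1)}`. -/
def rectSD : Finset SD16 :=
  {⟨ofAdd 0, ofAdd 0⟩, ⟨ofAdd 0, ofAdd 1⟩, ⟨ofAdd 1, ofAdd 1⟩, ⟨ofAdd 2, ofAdd 1⟩,
    ⟨ofAdd 3, ofAdd 0⟩, ⟨ofAdd 5, ofAdd 0⟩, ⟨ofAdd 6, ofAdd 0⟩, ⟨ofAdd 7, ofAdd 1⟩}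

/-- A CM type of `M₁₆` that is both a segment and a twisted-rectangle instance:
`{(0,0), (0,1), (1,0), (3,0), (5,1), (6,0), (6,1), (7,1)}`. -/
def typeM : Finset M16 :=
  {⟨ofAdd 0, ofAdd 0⟩, ⟨ofAdd 0, ofAdd 1⟩, ⟨ofAdd 1, ofAdd 0⟩, ⟨ofAdd 3, ofAdd 0⟩,
    ⟨ofAdd 5, ofAdd 1⟩, ⟨ofAdd 6, ofAdd 0⟩, ⟨ofAdd 6, ofAdd 1⟩, ⟨ofAdd 7, ofAdd 1⟩}

/-! ### Transport from a model group to an ambient group -/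

variable {G : Type*} [Group G]

/-- **Transport.**  An injective `ψ : TwistGroup s →* G` with `ψ c = c_G`, and a subset `Φ₀` of the model group that
is a CM type for `c`, `SumTwo` for the twists `t` and without a conjugate pair (three decidable conditions), give a
CM type of `(G, c_G)` whose twists by the `ψ (t i)` are `SumTwo` without a conjugate pair. -/
theorem exists_quad_of_model [Fintype G] [DecidableEq G] {s : ZMod 8} {hs : s * s = 1}
    (ψ : TwistGroup s hs →* G) (hψ : Function.Injective ψ) {c : G} (hc : IsComplexConj c)
    (he : ψ (tc s hs) = c) (t : Fin 4 → TwistGroup s hs) (Φ₀ : Finset (TwistGroup s hs))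
    (h1 : ∀ p, decide (p * tc s hs ∈ Φ₀) = !decide (p ∈ Φ₀))
    (h2 : ∀ p, (univ.filter fun i : Fin 4 => decide (p * (t i)⁻¹ ∈ Φ₀) = true).card = 2)
    (h3 : ∀ i j : Fin 4, ¬ ∀ p, (decide (p * (t j)⁻¹ ∈ Φ₀) = true ↔
      decide (p * (tc s hs * (t i)⁻¹) ∈ Φ₀) = true)) :
    ∃ Φ : Finset G, IsCMType c Φ ∧ SumTwo (fun i => rmul Φ (ψ (t i))) ∧
      ∀ i j : Fin 4, rmul Φ (ψ (t j)) ≠ c • rmul Φ (ψ (t i)) := by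
  have hcard : Fintype.card (Fin 1) * Fintype.card (TwistGroup s hs) ≤ Fintype.card G := by
    rw [Fintype.card_fin, one_mul]
    exact Fintype.card_le_of_injective ψ hψ
  exact exists_quad_of_pattern ψ hψ hc he t (fun (_ : Fin 1) p => decide (p ∈ Φ₀)) (fun _ p => h1 p)
    (fun _ p => h2 p) (fun i j h => h3 i j (fun p => h 0 p)) hcard

/-- `twistAut s x = ofAdd (s · toAdd x)`. -/
theorem twistAut_apply (s : ZMod 8) (hs : s * s = 1) (x : Multiplicative (ZMod 8)) :
    twistAut s hs x = ofAdd (s * toAdd x) := rfl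

/-- `twistPhi s` is trivial on the identity. -/
theorem twistPhi_zero (s : ZMod 8) (hs : s * s = 1) : twistPhi s hs (ofAdd 0) = 1 := by
  rw [twistPhi, zmodPowHom_apply, toAdd_ofAdd, ZMod.val_zero, pow_zero]

/-- `twistPhi s` sends the generator to `twistAut s`. -/
theorem twistPhi_one (s : ZMod 8) (hs : s * s = 1) : twistPhi s hs (ofAdd 1) = twistAut s hs := by
  rw [twistPhi, zmodPowHom_apply, toAdd_ofAdd, val_one_two, pow_one]

/-- The compatibility of the power homs with the twist: `v^{s n} = u vⁿ u⁻¹`. -/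
theorem twist_compat {s : ZMod 8} (hs : s * s = 1) (v u : G) (hv : v ^ 8 = 1) (hu : u ^ 2 = 1)
    (huv : u * v * u⁻¹ = v ^ s.val) (g : Multiplicative (ZMod 2)) :
    (zmodPowHom 8 v hv).comp (MulEquiv.toMonoidHom (twistPhi s hs g)) =
      (MulEquiv.toMonoidHom (MulAut.conj (zmodPowHom 2 u hu g))).comp (zmodPowHom 8 v hv) := by
  obtain ⟨g, rfl⟩ := ofAdd.surjective g
  refine MonoidHom.ext (fun n => ?_)
  rw [MonoidHom.comp_apply, MonoidHom.comp_apply, MulEquiv.coe_toMonoidHom, MulEquiv.coe_toMonoidHom,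
    MulAut.conj_apply]
  rcases (show ∀ x : ZMod 2, x = 0 ∨ x = 1 by decide) g with rfl | rfl
  · rw [twistPhi_zero, MulAut.one_apply, zmodPowHom_apply, zmodPowHom_apply, toAdd_ofAdd, ZMod.val_zero,
      pow_zero, one_mul, inv_one, mul_one]
  · rw [twistPhi_one, twistAut_apply, zmodPowHom_apply, zmodPowHom_apply, zmodPowHom_apply, toAdd_ofAdd,
      toAdd_ofAdd, val_one_two, pow_one, ZMod.val_mul, pow_mod_of_pow_eq_one hv, pow_mul, ← huv, conj_pow]

/-- The hom `TwistGroup s →* G` from `v` with `v⁸ = 1` and `u` with `u² = 1`, `u v u⁻¹ = v^{s}`: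
`(n, g) ↦ vⁿ uᵍ`. -/
def modelHom {s : ZMod 8} {hs : s * s = 1} (v u : G) (hv : v ^ 8 = 1) (hu : u ^ 2 = 1)
    (huv : u * v * u⁻¹ = v ^ s.val) : TwistGroup s hs →* G :=
  SemidirectProduct.lift (zmodPowHom 8 v hv) (zmodPowHom 2 u hu) (twist_compat hs v u hv hu huv)

/-- `modelHom` on `(n, g)`: `vⁿ uᵍ`. -/
theorem modelHom_mk {s : ZMod 8} {hs : s * s = 1} (v u : G) (hv : v ^ 8 = 1) (hu : u ^ 2 = 1)
    (huv : u * v * u⁻¹ = v ^ s.val) (n : Multiplicative (ZMod 8)) (g : Multiplicative (ZMod 2)) :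
    modelHom (hs := hs) v u hv hu huv ⟨n, g⟩ = v ^ (toAdd n).val * u ^ (toAdd g).val := by
  rw [SemidirectProduct.mk_eq_inl_mul_inr, map_mul, modelHom, SemidirectProduct.lift_inl,
    SemidirectProduct.lift_inr, zmodPowHom_apply, zmodPowHom_apply]

/-- `modelHom v = v`. -/
theorem modelHom_tv {s : ZMod 8} {hs : s * s = 1} (v u : G) (hv : v ^ 8 = 1) (hu : u ^ 2 = 1)
    (huv : u * v * u⁻¹ = v ^ s.val) : modelHom (hs := hs) v u hv hu huv (tv s hs) = v := by
  rw [tv, modelHom, SemidirectProduct.lift_inl, zmodPowHom_apply, toAdd_ofAdd]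
  have h1 : (1 : ZMod 8).val = 1 := by decide
  rw [h1, pow_one]

/-- `modelHom u = u`. -/
theorem modelHom_tu {s : ZMod 8} {hs : s * s = 1} (v u : G) (hv : v ^ 8 = 1) (hu : u ^ 2 = 1)
    (huv : u * v * u⁻¹ = v ^ s.val) : modelHom (hs := hs) v u hv hu huv (tu s hs) = u := by
  rw [tu, modelHom, SemidirectProduct.lift_inr, zmodPowHom_apply, toAdd_ofAdd, val_one_two, pow_one]

/-- `modelHom c = v⁴`. -/
theorem modelHom_tc {s : ZMod 8} {hs : s * s = 1} (v u : G) (hv : v ^ 8 = 1) (hu : u ^ 2 = 1)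
    (huv : u * v * u⁻¹ = v ^ s.val) : modelHom (hs := hs) v u hv hu huv (tc s hs) = v ^ 4 := by
  rw [tc, modelHom, SemidirectProduct.lift_inl, zmodPowHom_apply, toAdd_ofAdd]
  have h4 : (4 : ZMod 8).val = 4 := by decide
  rw [h4]

/-- `modelHom` is injective when `v` has order exactly `8` and `u ∉ ⟨v⟩`. -/
theorem modelHom_injective {s : ZMod 8} {hs : s * s = 1} (v u : G) (hv : v ^ 8 = 1) (hu : u ^ 2 = 1)
    (huv : u * v * u⁻¹ = v ^ s.val) (hv8 : orderOf v = 8) (hnot : u ∉ Subgroup.zpowers v) :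
    Function.Injective (modelHom (hs := hs) v u hv hu huv) := by
  rw [injective_iff_map_eq_one]
  rintro ⟨n, g⟩ hx
  rw [modelHom_mk] at hx
  obtain ⟨g, rfl⟩ := ofAdd.surjective g
  rcases (show ∀ x : ZMod 2, x = 0 ∨ x = 1 by decide) g with rfl | rfl
  · rw [toAdd_ofAdd, ZMod.val_zero, pow_zero, mul_one] at hx
    have h8 : 8 ∣ (toAdd n).val := by
      have hdvd := orderOf_dvd_of_pow_eq_one hx
      rwa [hv8] at hdvd
    have hn0 : (toAdd n).val = 0 := Nat.eq_zero_of_dvd_of_lt h8 (ZMod.val_lt _)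
    have hn : toAdd n = 0 := (ZMod.val_eq_zero _).mp hn0
    refine SemidirectProduct.ext ?_ ?_
    · show n = 1
      rw [← ofAdd_toAdd n, hn, ofAdd_zero]
    · show ofAdd (0 : ZMod 2) = 1
      exact ofAdd_zero
  · rw [toAdd_ofAdd, val_one_two, pow_one] at hx
    exfalso
    apply hnot
    rw [eq_inv_of_mul_eq_one_right hx]
    exact Subgroup.inv_mem _ (Subgroup.npow_mem_zpowers v _)

/-! ### The four existence theorems -/

/-- The ambient conditions on `v, u` for `TwistGroup s`: `v` of order `8`, `u` an involution outside `⟨v⟩` acting by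
`v ↦ vˢ`, and `c = v⁴`. -/
theorem exists_quad_of_twist [Fintype G] [DecidableEq G] {c : G} (hc : IsComplexConj c) (v u : G)
    {s : ZMod 8} {hs : s * s = 1} (hv8 : orderOf v = 8) (hu : u ^ 2 = 1) (huv : u * v * u⁻¹ = v ^ s.val)
    (hnot : u ∉ Subgroup.zpowers v) (hc4 : v ^ 4 = c) (t : Fin 4 → TwistGroup s hs)
    (Φ₀ : Finset (TwistGroup s hs))
    (h1 : ∀ p, decide (p * tc s hs ∈ Φ₀) = !decide (p ∈ Φ₀))
    (h2 : ∀ p, (univ.filter fun i : Fin 4 => decide (p * (t i)⁻¹ ∈ Φ₀) = true).card = 2)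
    (h3 : ∀ i j : Fin 4, ¬ ∀ p, (decide (p * (t j)⁻¹ ∈ Φ₀) = true ↔
      decide (p * (tc s hs * (t i)⁻¹) ∈ Φ₀) = true)) :
    ∃ Φ : Finset G, IsCMType c Φ ∧
      SumTwo (fun i => rmul Φ (modelHom (hs := hs) v u (hv8 ▸ pow_orderOf_eq_one v) hu huv (t i))) ∧
      ∀ i j : Fin 4, rmul Φ (modelHom (hs := hs) v u (hv8 ▸ pow_orderOf_eq_one v) hu huv (t j)) ≠
        c • rmul Φ (modelHom (hs := hs) v u (hv8 ▸ pow_orderOf_eq_one v) hu huv (t i)) :=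
  exists_quad_of_model _ (modelHom_injective v u _ hu huv hv8 hnot) hc
    (by rw [modelHom_tc, hc4]) t Φ₀ h1 h2 h3

/-- The twists of the segment `![1, v, v², u]` are the images of `segSDT`. -/
theorem modelHom_segSDT {s : ZMod 8} {hs : s * s = 1} (v u : G) (hv : v ^ 8 = 1) (hu : u ^ 2 = 1)
    (huv : u * v * u⁻¹ = v ^ s.val) (i : Fin 4) :
    modelHom (hs := hs) v u hv hu huv (segSDT s hs i) = ![1, v, v ^ 2, u] i := by
  fin_cases i
  · exact map_one _
  · exact modelHom_tv v u hv hu huv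
  · show modelHom (hs := hs) v u hv hu huv (tv s hs ^ 2) = v ^ 2
    rw [map_pow, modelHom_tv]
  · exact modelHom_tu v u hv hu huv

/-- The twists of the segment `![1, v, v², v³ u]` are the images of `segMT`. -/
theorem modelHom_segMT {s : ZMod 8} {hs : s * s = 1} (v u : G) (hv : v ^ 8 = 1) (hu : u ^ 2 = 1)
    (huv : u * v * u⁻¹ = v ^ s.val) (i : Fin 4) :
    modelHom (hs := hs) v u hv hu huv (segMT s hs i) = ![1, v, v ^ 2, v ^ 3 * u] i := by
  fin_cases i
  · exact map_one _
  · exact modelHom_tv v u hv hu huv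
  · show modelHom (hs := hs) v u hv hu huv (tv s hs ^ 2) = v ^ 2
    rw [map_pow, modelHom_tv]
  · show modelHom (hs := hs) v u hv hu huv (tv s hs ^ 3 * tu s hs) = v ^ 3 * u
    rw [map_mul, map_pow, modelHom_tv, modelHom_tu]

/-- The twists of the rectangle `![1, u, v, v u]` are the images of `rectT`. -/
theorem modelHom_rectT {s : ZMod 8} {hs : s * s = 1} (v u : G) (hv : v ^ 8 = 1) (hu : u ^ 2 = 1)
    (huv : u * v * u⁻¹ = v ^ s.val) (i : Fin 4) :
    modelHom (hs := hs) v u hv hu huv (rectT s hs i) = ![1, u, v, v * u] i := by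
  fin_cases i
  · exact map_one _
  · exact modelHom_tu v u hv hu huv
  · exact modelHom_tv v u hv hu huv
  · show modelHom (hs := hs) v u hv hu huv (tv s hs * tu s hs) = v * u
    rw [map_mul, modelHom_tv, modelHom_tu]

/-- `(3 : ℤ/8).val = 3`. -/
theorem val_three : (3 : ZMod 8).val = 3 := by decide

/-- `(5 : ℤ/8).val = 5`. -/
theorem val_five : (5 : ZMod 8).val = 5 := by decide

/-- **Theorem S on `SD₁₆` (route-2 §9.39, kernel existence).**  For every finite `(G, c)`, `v` of order `8` with
`v⁴ = c` and an involution `u ∉ ⟨v⟩` with `u v u⁻¹ = v³` (`= c v⁻¹`): some CM type `Φ` has the twisted segment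
`Φ, Φv, Φv², Φu` `SumTwo` without a conjugate pair. -/
theorem exists_segmentQuad_SD16 [Fintype G] [DecidableEq G] {c : G} (hc : IsComplexConj c) (v u : G)
    (hv8 : orderOf v = 8) (hu : u ^ 2 = 1) (huv : u * v * u⁻¹ = v ^ 3) (hnot : u ∉ Subgroup.zpowers v)
    (hc4 : v ^ 4 = c) :
    ∃ Φ : Finset G, IsCMType c Φ ∧ SumTwo (fun i => rmul Φ (![1, v, v ^ 2, u] i)) ∧
      ∀ i j : Fin 4, rmul Φ (![1, v, v ^ 2, u] j) ≠ c • rmul Φ (![1, v, v ^ 2, u] i) := by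
  have huv' : u * v * u⁻¹ = v ^ (3 : ZMod 8).val := by rw [val_three]; exact huv
  obtain ⟨Φ, h1, h2, h3⟩ := exists_quad_of_twist hc v u (hs := three_sq) hv8 hu huv' hnot hc4
    (segSDT 3 three_sq) segSD (by decide) (by decide) (by decide)
  simp only [modelHom_segSDT] at h2 h3
  exact ⟨Φ, h1, h2, h3⟩

/-- **Theorem T (i) on `SD₁₆` (route-2 §9.39, `k = 4`, `ε = −`, kernel existence).**  For every finite `(G, c)`,
`v` of order `8` with `v⁴ = c` and an involution `u ∉ ⟨v⟩` with `u v u⁻¹ = v³`: some CM type `Φ` has the twisted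
rectangle `Φ, Φu, Φv, Φ(vu)` `SumTwo` without a conjugate pair. -/
theorem exists_twistedRectQuad_SD16 [Fintype G] [DecidableEq G] {c : G} (hc : IsComplexConj c) (v u : G)
    (hv8 : orderOf v = 8) (hu : u ^ 2 = 1) (huv : u * v * u⁻¹ = v ^ 3) (hnot : u ∉ Subgroup.zpowers v)
    (hc4 : v ^ 4 = c) :
    ∃ Φ : Finset G, IsCMType c Φ ∧ SumTwo (fun i => rmul Φ (![1, u, v, v * u] i)) ∧
      ∀ i j : Fin 4, rmul Φ (![1, u, v, v * u] j) ≠ c • rmul Φ (![1, u, v, v * u] i) := by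
  have huv' : u * v * u⁻¹ = v ^ (3 : ZMod 8).val := by rw [val_three]; exact huv
  obtain ⟨Φ, h1, h2, h3⟩ := exists_quad_of_twist hc v u (hs := three_sq) hv8 hu huv' hnot hc4
    (rectT 3 three_sq) rectSD (by decide) (by decide) (by decide)
  simp only [modelHom_rectT] at h2 h3
  exact ⟨Φ, h1, h2, h3⟩

/-- **Theorem S on `M₁₆` (route-2 §9.39, the `(M)` form, kernel existence).**  For every finite `(G, c)`, `v` of
order `8` with `v⁴ = c` and an involution `u ∉ ⟨v⟩` with `u v u⁻¹ = v⁵` (`= c v`): some CM type `Φ` has the twisted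
segment `Φ, Φv, Φv², Φw` with `w = v³ u` (`w² = v²`, `w v w⁻¹ = c v`) `SumTwo` without a conjugate pair. -/
theorem exists_segmentQuad_M16 [Fintype G] [DecidableEq G] {c : G} (hc : IsComplexConj c) (v u : G)
    (hv8 : orderOf v = 8) (hu : u ^ 2 = 1) (huv : u * v * u⁻¹ = v ^ 5) (hnot : u ∉ Subgroup.zpowers v)
    (hc4 : v ^ 4 = c) :
    ∃ Φ : Finset G, IsCMType c Φ ∧ SumTwo (fun i => rmul Φ (![1, v, v ^ 2, v ^ 3 * u] i)) ∧
      ∀ i j : Fin 4, rmul Φ (![1, v, v ^ 2, v ^ 3 * u] j) ≠ c • rmul Φ (![1, v, v ^ 2, v ^ 3 * u] i) := by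
  have huv' : u * v * u⁻¹ = v ^ (5 : ZMod 8).val := by rw [val_five]; exact huv
  obtain ⟨Φ, h1, h2, h3⟩ := exists_quad_of_twist hc v u (hs := five_sq) hv8 hu huv' hnot hc4
    (segMT 5 five_sq) typeM (by decide) (by decide) (by decide)
  simp only [modelHom_segMT] at h2 h3
  exact ⟨Φ, h1, h2, h3⟩

/-- **Theorem T (i) on `M₁₆` (route-2 §9.39, `k = 4`, `ε = +`, kernel existence).**  For every finite `(G, c)`,
`v` of order `8` with `v⁴ = c` and an involution `u ∉ ⟨v⟩` with `u v u⁻¹ = v⁵`: some CM type `Φ` has the twisted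
rectangle `Φ, Φu, Φv, Φ(vu)` `SumTwo` without a conjugate pair. -/
theorem exists_twistedRectQuad_M16 [Fintype G] [DecidableEq G] {c : G} (hc : IsComplexConj c) (v u : G)
    (hv8 : orderOf v = 8) (hu : u ^ 2 = 1) (huv : u * v * u⁻¹ = v ^ 5) (hnot : u ∉ Subgroup.zpowers v)
    (hc4 : v ^ 4 = c) :
    ∃ Φ : Finset G, IsCMType c Φ ∧ SumTwo (fun i => rmul Φ (![1, u, v, v * u] i)) ∧
      ∀ i j : Fin 4, rmul Φ (![1, u, v, v * u] j) ≠ c • rmul Φ (![1, u, v, v * u] i) := by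
  have huv' : u * v * u⁻¹ = v ^ (5 : ZMod 8).val := by rw [val_five]; exact huv
  obtain ⟨Φ, h1, h2, h3⟩ := exists_quad_of_twist hc v u (hs := five_sq) hv8 hu huv' hnot hc4
    (rectT 5 five_sq) typeM (by decide) (by decide) (by decide)
  simp only [modelHom_rectT] at h2 h3
  exact ⟨Φ, h1, h2, h3⟩

/-! ### The model groups themselves (degree 16) -/

/-- `v` has order `8` in `SD₁₆`. -/
theorem orderOf_tv_SD16 : orderOf (tv 3 three_sq) = 8 := by
  rw [orderOf_eq_iff (by norm_num)]
  exact ⟨by decide, by decide⟩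

/-- `v` has order `8` in `M₁₆`. -/
theorem orderOf_tv_M16 : orderOf (tv 5 five_sq) = 8 := by
  rw [orderOf_eq_iff (by norm_num)]
  exact ⟨by decide, by decide⟩

/-- `u ∉ ⟨v⟩` in every model group (the right projection separates them). -/
theorem tu_not_mem_zpowers (s : ZMod 8) (hs : s * s = 1) : tu s hs ∉ Subgroup.zpowers (tv s hs) := by
  intro h
  obtain ⟨k, hk⟩ := Subgroup.mem_zpowers_iff.mp h
  have h' := congrArg SemidirectProduct.rightHom hk
  rw [map_zpow, tv, SemidirectProduct.rightHom_inl, one_zpow, tu, SemidirectProduct.rightHom_inr] at h'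
  exact absurd h' (by decide)

/-- `c = v⁴` is a complex conjugation of `SD₁₆`. -/
theorem isComplexConj_tc_SD16 : IsComplexConj (tc 3 three_sq) := ⟨by decide, by decide, by decide⟩

/-- `c = v⁴` is a complex conjugation of `M₁₆`. -/
theorem isComplexConj_tc_M16 : IsComplexConj (tc 5 five_sq) := ⟨by decide, by decide, by decide⟩

/-- The twisted segment on `SD₁₆` itself (degree 16; ROUTE-B §9.17's segment instances). -/
theorem exists_segmentQuad_on_SD16 : ∃ Φ : Finset SD16, IsCMType (tc 3 three_sq) Φ ∧
    SumTwo (fun i => rmul Φ (![1, tv 3 three_sq, tv 3 three_sq ^ 2, tu 3 three_sq] i)) ∧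
    ∀ i j : Fin 4, rmul Φ (![1, tv 3 three_sq, tv 3 three_sq ^ 2, tu 3 three_sq] j) ≠
      tc 3 three_sq • rmul Φ (![1, tv 3 three_sq, tv 3 three_sq ^ 2, tu 3 three_sq] i) :=
  exists_segmentQuad_SD16 isComplexConj_tc_SD16 _ _ orderOf_tv_SD16 (by decide) (by decide)
    (tu_not_mem_zpowers _ _) (by decide)

/-- The twisted rectangle on `SD₁₆` itself (degree 16; ROUTE-B §9.17's T instances). -/
theorem exists_twistedRectQuad_on_SD16 : ∃ Φ : Finset SD16, IsCMType (tc 3 three_sq) Φ ∧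
    SumTwo (fun i => rmul Φ (![1, tu 3 three_sq, tv 3 three_sq, tv 3 three_sq * tu 3 three_sq] i)) ∧
    ∀ i j : Fin 4, rmul Φ (![1, tu 3 three_sq, tv 3 three_sq, tv 3 three_sq * tu 3 three_sq] j) ≠
      tc 3 three_sq • rmul Φ (![1, tu 3 three_sq, tv 3 three_sq, tv 3 three_sq * tu 3 three_sq] i) :=
  exists_twistedRectQuad_SD16 isComplexConj_tc_SD16 _ _ orderOf_tv_SD16 (by decide) (by decide)
    (tu_not_mem_zpowers _ _) (by decide)

/-- The twisted segment on `M₁₆` itself. -/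
theorem exists_segmentQuad_on_M16 : ∃ Φ : Finset M16, IsCMType (tc 5 five_sq) Φ ∧
    SumTwo (fun i => rmul Φ (![1, tv 5 five_sq, tv 5 five_sq ^ 2, tv 5 five_sq ^ 3 * tu 5 five_sq] i)) ∧
    ∀ i j : Fin 4, rmul Φ (![1, tv 5 five_sq, tv 5 five_sq ^ 2, tv 5 five_sq ^ 3 * tu 5 five_sq] j) ≠
      tc 5 five_sq • rmul Φ (![1, tv 5 five_sq, tv 5 five_sq ^ 2, tv 5 five_sq ^ 3 * tu 5 five_sq] i) :=
  exists_segmentQuad_M16 isComplexConj_tc_M16 _ _ orderOf_tv_M16 (by decide) (by decide)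
    (tu_not_mem_zpowers _ _) (by decide)

/-- The twisted rectangle on `M₁₆` itself. -/
theorem exists_twistedRectQuad_on_M16 : ∃ Φ : Finset M16, IsCMType (tc 5 five_sq) Φ ∧
    SumTwo (fun i => rmul Φ (![1, tu 5 five_sq, tv 5 five_sq, tv 5 five_sq * tu 5 five_sq] i)) ∧
    ∀ i j : Fin 4, rmul Φ (![1, tu 5 five_sq, tv 5 five_sq, tv 5 five_sq * tu 5 five_sq] j) ≠
      tc 5 five_sq • rmul Φ (![1, tu 5 five_sq, tv 5 five_sq, tv 5 five_sq * tu 5 five_sq] i) :=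
  exists_twistedRectQuad_M16 isComplexConj_tc_M16 _ _ orderOf_tv_M16 (by decide) (by decide)
    (tu_not_mem_zpowers _ _) (by decide)
end HodgeRepro.TwistedQuad
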